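import Mathlib.Analysis.Calculus.DerivativeTest
import Mathlib.Analysis.Calculus.Deriv.Slope
import Mathlib.Topology.Order.Compact
import HarnessLib

/-!
# The weak maximum principle for one-dimensional parabolic operators

Analysis/PDE support file (everything proved; no definitions, no named facts). For the decay
estimates of A. Waldron, *Long-time existence for Yang–Mills flow*, Invent. math. 217 (2019), §5
("by the comparison principle, we have `f₁ ≤ u`" for the operator
`□ = ∂ₜ − (∂ᵣ² + ∂ᵣ/r − 4/r²)` on `[ρ, 1] × [0, T)`), we prove the classical weak maximum
principle for `L u = uₜ − A u_rr − B u_r + C u` with `A ≥ 0`, `C ≥ 0` on a rectangle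
`[a, b] × [0, T]`: if `L u ≤ 0` in `(a, b) × (0, T]` and `u ≤ 0` on the parabolic boundary, then
`u ≤ 0` — Lieberman's Lemma 2.1/2.3 in one space dimension (perturb by `ε(1 + t)`, look at a
positive maximum: `u_r = 0`, `u_rr ≤ 0`, `uₜ ≥ 0` there).

* `deriv_deriv_nonpos_of_isLocalMax` — the second-order necessary condition at a local maximum;
* `nonneg_of_hasDerivWithinAt_Iic_of_le` — a left derivative at a right-endpoint maximum is `≥ 0`;
* `nonpos_of_parabolic_subsolution_1d` — **the weak maximum principle**;
* `le_of_parabolic_comparison_1d` — **the comparison principle** for two functions.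

References: G. M. Lieberman, *Second order parabolic differential equations* (1996), Ch. II,
Lemma 2.1 and Lemma 2.3 [Lieberman1996]; A. Waldron, Invent. math. 217 (2019), §5
[Waldron2019].
-/

noncomputable section

open Set Filter Topology

namespace Literature.Analysis.PDE

/-- **Second-order necessary condition**: if `f` has a local maximum at `x₀`, is differentiable
near `x₀` with derivative `f'`, and `f'` has derivative `f''(x₀)` at `x₀`, then `f''(x₀) ≤ 0`.
[folklore] -/
theorem deriv_deriv_nonpos_of_isLocalMax {f f' : ℝ → ℝ} {x₀ f'' : ℝ} (hmax : IsLocalMax f x₀)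
    (hf' : ∀ᶠ x in 𝓝 x₀, HasDerivAt f (f' x) x) (hf'' : HasDerivAt f' f'' x₀) : f'' ≤ 0 := by
  by_contra hpos'
  have hpos : 0 < f'' := not_le.1 hpos'
  have hcont : ContinuousAt f x₀ := (hf'.self_of_nhds).continuousAt
  have hd : deriv f =ᶠ[𝓝 x₀] f' := hf'.mono fun x hx => hx.deriv
  have hd0 : deriv f x₀ = 0 := hmax.deriv_eq_zero
  have hdd : deriv (deriv f) x₀ = f'' := by rw [hd.deriv_eq]; exact hf''.deriv
  have hmin : IsLocalMin f x₀ := isLocalMin_of_deriv_deriv_pos (by rw [hdd]; exact hpos) hd0 hcont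
  -- `f` is locally constant at `x₀`, so its second derivative vanishes there
  have hconst : f =ᶠ[𝓝 x₀] fun _ => f x₀ := by
    filter_upwards [hmax, hmin] with x h1 h2
    exact le_antisymm h1 h2
  have hderiv0 : deriv f =ᶠ[𝓝 x₀] fun _ => 0 := by
    have h := hconst.eventuallyEq_nhds
    filter_upwards [h] with x hx
    rw [hx.deriv_eq, deriv_const]
  have : deriv (deriv f) x₀ = 0 := by rw [hderiv0.deriv_eq, deriv_const]
  rw [hdd] at this
  exact (lt_irrefl 0) (this ▸ hpos)

/-- **A left derivative at a right-endpoint maximum is nonnegative**: if `g` has the left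
derivative `g'` at `t₀` within `(-∞, t₀]` and `g(t) ≤ g(t₀)` for `t ≤ t₀` near `t₀`, then
`0 ≤ g'`. [folklore] -/
theorem nonneg_of_hasDerivWithinAt_Iic_of_le {g : ℝ → ℝ} {t₀ g' : ℝ}
    (hg : HasDerivWithinAt g g' (Iic t₀) t₀) (hle : ∀ᶠ t in 𝓝[<] t₀, g t ≤ g t₀) : 0 ≤ g' := by
  have ht : Tendsto (slope g t₀) (𝓝[Iic t₀ \ {t₀}] t₀) (𝓝 g') :=
    hasDerivWithinAt_iff_tendsto_slope.1 hg
  have hset : Iic t₀ \ {t₀} = Iio t₀ := by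
    ext t; simp [lt_iff_le_and_ne]
  rw [hset] at ht
  refine ge_of_tendsto ht ?_
  filter_upwards [hle, self_mem_nhdsWithin] with t h1 h2
  rw [slope_def_field]
  exact div_nonneg_of_nonpos (by linarith) (by linarith [mem_Iio.1 h2])

/-- **The weak maximum principle for `L u = uₜ − A u_rr − B u_r + C u` in one space dimension**
(`A ≥ 0`, `C ≥ 0`). Let `u` be continuous on `[a, b] × [0, T]`, with space derivatives `u_r`,
`u_rr` and a left time derivative `uₜ` at every point of `(a, b) × (0, T]`, satisfying
`uₜ − A u_rr − B u_r + C u ≤ 0` there. If `u ≤ 0` on the parabolic boundary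
(`t = 0`, `r = a`, `r = b`), then `u ≤ 0` on `[a, b] × [0, T]`.
[cite: Lieberman1996, Lemma 2.1 and Lemma 2.3 (one space dimension)] -/
theorem nonpos_of_parabolic_subsolution_1d {u ut ur urr A B C : ℝ → ℝ → ℝ} {a b T : ℝ}
    (hu : ContinuousOn (fun p : ℝ × ℝ => u p.1 p.2) (Icc a b ×ˢ Icc 0 T))
    (hur : ∀ r ∈ Ioo a b, ∀ t ∈ Ioc 0 T, HasDerivAt (fun r' => u r' t) (ur r t) r)
    (hurr : ∀ r ∈ Ioo a b, ∀ t ∈ Ioc 0 T, HasDerivAt (fun r' => ur r' t) (urr r t) r)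
    (hut : ∀ r ∈ Ioo a b, ∀ t ∈ Ioc 0 T, HasDerivWithinAt (fun t' => u r t') (ut r t) (Iic t) t)
    (hA : ∀ r ∈ Ioo a b, ∀ t ∈ Ioc 0 T, 0 ≤ A r t) (hC : ∀ r ∈ Ioo a b, ∀ t ∈ Ioc 0 T, 0 ≤ C r t)
    (hL : ∀ r ∈ Ioo a b, ∀ t ∈ Ioc 0 T,
      ut r t - A r t * urr r t - B r t * ur r t + C r t * u r t ≤ 0)
    (h0 : ∀ r ∈ Icc a b, u r 0 ≤ 0) (ha : ∀ t ∈ Icc 0 T, u a t ≤ 0) (hb : ∀ t ∈ Icc 0 T, u b t ≤ 0) :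
    ∀ r ∈ Icc a b, ∀ t ∈ Icc 0 T, u r t ≤ 0 := by
  intro r₁ hr₁ t₁ ht₁
  have hT : 0 ≤ T := ht₁.1.trans ht₁.2
  -- it suffices to prove `u ≤ ε (1 + T)` for every `ε > 0`
  refine le_of_forall_pos_le_add fun δ hδ => ?_
  rw [zero_add]
  set ε : ℝ := δ / (1 + T) with hε
  have hεpos : 0 < ε := by positivity
  have hεT : ε * (1 + T) = δ := by rw [hε]; field_simp
  -- the perturbed function `w = u − ε (1 + t)` on the compact rectangle
  set w : ℝ × ℝ → ℝ := fun p => u p.1 p.2 - ε * (1 + p.2) with hw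
  have hK : IsCompact (Icc a b ×ˢ Icc (0 : ℝ) T) := isCompact_Icc.prod isCompact_Icc
  have hne : (Icc a b ×ˢ Icc (0 : ℝ) T).Nonempty := ⟨(r₁, t₁), hr₁, ht₁⟩
  have hwc : ContinuousOn w (Icc a b ×ˢ Icc 0 T) :=
    hu.sub ((continuous_const.mul (continuous_const.add continuous_snd)).continuousOn)
  obtain ⟨p₀, hp₀, hmax⟩ := hK.exists_isMaxOn hne hwc
  obtain ⟨r₀, t₀⟩ := p₀
  have hmax' : ∀ p ∈ Icc a b ×ˢ Icc (0 : ℝ) T, w p ≤ w (r₀, t₀) := isMaxOn_iff.1 hmax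
  have hw₁ : w (r₁, t₁) ≤ w (r₀, t₀) := hmax' _ ⟨hr₁, ht₁⟩
  -- if the maximum of `w` is `≤ 0` we are done
  rcases le_or_gt (w (r₀, t₀)) 0 with hle | hle
  · have : u r₁ t₁ - ε * (1 + t₁) ≤ 0 := hw₁.trans hle
    have : ε * (1 + t₁) ≤ ε * (1 + T) := mul_le_mul_of_nonneg_left (by linarith [ht₁.2]) hεpos.le
    linarith
  exfalso
  have hr₀ : r₀ ∈ Icc a b := hp₀.1
  have ht₀ : t₀ ∈ Icc (0 : ℝ) T := hp₀.2
  have hu₀ : 0 < u r₀ t₀ := by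
    have : (0 : ℝ) < u r₀ t₀ - ε * (1 + t₀) := hle
    nlinarith [ht₀.1]
  -- the maximum point is not on the parabolic boundary
  have ht₀0 : t₀ ≠ 0 := fun h => (lt_irrefl (0 : ℝ)) (hu₀.trans_le (h ▸ h0 r₀ hr₀))
  have hr₀a : r₀ ≠ a := fun h => (lt_irrefl (0 : ℝ)) (hu₀.trans_le (h ▸ ha t₀ ht₀))
  have hr₀b : r₀ ≠ b := fun h => (lt_irrefl (0 : ℝ)) (hu₀.trans_le (h ▸ hb t₀ ht₀))
  have hr₀' : r₀ ∈ Ioo a b := ⟨lt_of_le_of_ne hr₀.1 (Ne.symm hr₀a), lt_of_le_of_ne hr₀.2 hr₀b⟩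
  have ht₀' : t₀ ∈ Ioc (0 : ℝ) T := ⟨lt_of_le_of_ne ht₀.1 (Ne.symm ht₀0), ht₀.2⟩
  -- ### the spatial conditions `u_r = 0`, `u_rr ≤ 0` at the maximum
  have hsmax : IsLocalMax (fun r => u r t₀ - ε * (1 + t₀)) r₀ := by
    have hnhds : Ioo a b ∈ 𝓝 r₀ := Ioo_mem_nhds hr₀'.1 hr₀'.2
    filter_upwards [hnhds] with r hr
    exact hmax' (r, t₀) ⟨Ioo_subset_Icc_self hr, ht₀⟩
  have hd1 : ∀ᶠ r in 𝓝 r₀, HasDerivAt (fun r => u r t₀ - ε * (1 + t₀)) (ur r t₀) r := by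
    filter_upwards [Ioo_mem_nhds hr₀'.1 hr₀'.2] with r hr
    exact (hur r hr t₀ ht₀').sub_const _
  have hurr0 : urr r₀ t₀ ≤ 0 :=
    deriv_deriv_nonpos_of_isLocalMax hsmax hd1 (hurr r₀ hr₀' t₀ ht₀')
  have hur0 : ur r₀ t₀ = 0 := by
    have h := hsmax.deriv_eq_zero
    rwa [((hur r₀ hr₀' t₀ ht₀').sub_const (ε * (1 + t₀))).deriv] at h
  -- ### the temporal condition `uₜ ≥ ε` at the maximum (left derivative of `w`)
  have hwt : HasDerivWithinAt (fun t => u r₀ t - ε * (1 + t)) (ut r₀ t₀ - ε) (Iic t₀) t₀ := by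
    have h1 := hut r₀ hr₀' t₀ ht₀'
    have h2 : HasDerivWithinAt (fun t => ε * (1 + t)) ε (Iic t₀) t₀ := by
      have := ((hasDerivAt_id t₀).const_add 1).const_mul ε
      simpa using this.hasDerivWithinAt
    exact h1.sub h2
  have hwle : ∀ᶠ t in 𝓝[<] t₀, u r₀ t - ε * (1 + t) ≤ u r₀ t₀ - ε * (1 + t₀) := by
    have hnhds : Ioo 0 t₀ ∈ 𝓝[<] t₀ := Ioo_mem_nhdsLT ht₀'.1
    filter_upwards [hnhds] with t ht
    exact hmax' (r₀, t) ⟨hr₀, ⟨ht.1.le, ht.2.le.trans ht₀.2⟩⟩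
  have hut0 : ε ≤ ut r₀ t₀ := by
    have := nonneg_of_hasDerivWithinAt_Iic_of_le hwt hwle
    linarith
  -- ### contradiction with `L u ≤ 0`
  have hLp := hL r₀ hr₀' t₀ ht₀'
  have hAt : 0 ≤ -(A r₀ t₀ * urr r₀ t₀) := by
    have := mul_nonneg (hA r₀ hr₀' t₀ ht₀') (neg_nonneg.2 hurr0)
    linarith
  have hCt : 0 ≤ C r₀ t₀ * u r₀ t₀ := mul_nonneg (hC r₀ hr₀' t₀ ht₀') hu₀.le
  rw [hur0, mul_zero, sub_zero] at hLp
  linarith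

/-- **The comparison principle** (one space dimension): for `L = ∂ₜ − A∂ᵣ² − B∂ᵣ + C` with
`A ≥ 0`, `C ≥ 0` on `(a, b) × (0, T]`, if `L u ≤ L v` there and `u ≤ v` on the parabolic boundary
of `[a, b] × [0, T]`, then `u ≤ v` (apply the weak maximum principle to `u − v`).
[cite: Lieberman1996, Lemma 2.3 (one space dimension); Waldron2019, §5] -/
theorem le_of_parabolic_comparison_1d {u ut ur urr v vt vr vrr A B C : ℝ → ℝ → ℝ} {a b T : ℝ}
    (hu : ContinuousOn (fun p : ℝ × ℝ => u p.1 p.2) (Icc a b ×ˢ Icc 0 T))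
    (hv : ContinuousOn (fun p : ℝ × ℝ => v p.1 p.2) (Icc a b ×ˢ Icc 0 T))
    (hur : ∀ r ∈ Ioo a b, ∀ t ∈ Ioc 0 T, HasDerivAt (fun r' => u r' t) (ur r t) r)
    (hurr : ∀ r ∈ Ioo a b, ∀ t ∈ Ioc 0 T, HasDerivAt (fun r' => ur r' t) (urr r t) r)
    (hut : ∀ r ∈ Ioo a b, ∀ t ∈ Ioc 0 T, HasDerivWithinAt (fun t' => u r t') (ut r t) (Iic t) t)
    (hvr : ∀ r ∈ Ioo a b, ∀ t ∈ Ioc 0 T, HasDerivAt (fun r' => v r' t) (vr r t) r)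
    (hvrr : ∀ r ∈ Ioo a b, ∀ t ∈ Ioc 0 T, HasDerivAt (fun r' => vr r' t) (vrr r t) r)
    (hvt : ∀ r ∈ Ioo a b, ∀ t ∈ Ioc 0 T, HasDerivWithinAt (fun t' => v r t') (vt r t) (Iic t) t)
    (hA : ∀ r ∈ Ioo a b, ∀ t ∈ Ioc 0 T, 0 ≤ A r t) (hC : ∀ r ∈ Ioo a b, ∀ t ∈ Ioc 0 T, 0 ≤ C r t)
    (hL : ∀ r ∈ Ioo a b, ∀ t ∈ Ioc 0 T,
      ut r t - A r t * urr r t - B r t * ur r t + C r t * u r t ≤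
        vt r t - A r t * vrr r t - B r t * vr r t + C r t * v r t)
    (h0 : ∀ r ∈ Icc a b, u r 0 ≤ v r 0) (ha : ∀ t ∈ Icc 0 T, u a t ≤ v a t)
    (hb : ∀ t ∈ Icc 0 T, u b t ≤ v b t) :
    ∀ r ∈ Icc a b, ∀ t ∈ Icc 0 T, u r t ≤ v r t := by
  have h := nonpos_of_parabolic_subsolution_1d (u := fun r t => u r t - v r t)
    (ut := fun r t => ut r t - vt r t) (ur := fun r t => ur r t - vr r t)
    (urr := fun r t => urr r t - vrr r t) (A := A) (B := B) (C := C) (a := a) (b := b) (T := T)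
    (hu.sub hv) (fun r hr t ht => (hur r hr t ht).sub (hvr r hr t ht))
    (fun r hr t ht => (hurr r hr t ht).sub (hvrr r hr t ht))
    (fun r hr t ht => (hut r hr t ht).sub (hvt r hr t ht)) hA hC
    (fun r hr t ht => by have := hL r hr t ht; nlinarith [this])
    (fun r hr => sub_nonpos.2 (h0 r hr)) (fun t ht => sub_nonpos.2 (ha t ht))
    (fun t ht => sub_nonpos.2 (hb t ht))
  intro r hr t ht
  exact sub_nonpos.1 (h r hr t ht)

end Literature.Analysis.PDE
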